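import Mathlib
import Summits.AtomisticToContinuum.Crystallization.Theses.LaminarSixThreeThree
import Literature.MathematicalPhysics.StatisticalMechanics.BarlowStacking
import Literature.MathematicalPhysics.StatisticalMechanics.HcpHomogeneous
import Literature.MathematicalPhysics.StatisticalMechanics.CrystallizationSymmetries

/-!
# Route LaminarSixThreeThree — `HcpWindowsToPeriodicWindows` (compactness glue)

Item `stmt-AtomisticToContinuum-14300` of route `LaminarSixThreeThree` (sub-problem `Crystallization`
of `AtomisticToContinuum`): if, for every radius `R` and tolerance `ε`, every sequence of
Lennard-Jones ground states eventually has a particle whose `R`-window is `ε`-matched (after a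
linear isometry) to a window of some relaxed hexagonal close packing `hcpStacking a h`,
`a, h ∈ (1/2, 2)`, then for every such sequence there is ONE periodic configuration `P` whose
windows are matched, frequently in `N`, by translates of the ground states (`PeriodicWindows`).

Proof (folklore compactness, Blanc–Lewin 2015 §2.1 for the notions): along
`(R_k, ε_k) = (k + 1, 1/(k + 5))` pick `N_k ≥ k`, a particle `i_k`, parameters `(a_k, h_k)`, a base
point `z_k ∈ hcpStacking a_k h_k` and an isometry `A_k`; by homogeneity of HCP
(`hcpStacking_homogeneous`) the window set `A_k (hcpStacking a_k h_k - z_k)` is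
`T_k (hcpStacking a_k h_k)` for a linear isometry `T_k`; extract a convergent subsequence of
`(a_k, h_k, T_k)` in the compact set `[1/2, 2]² × {isometries}`; the limit `(a, h, T)` gives
`P := T (hcpPeriodicConfiguration a h)` (`PeriodicConfiguration.isometryImage`); Barlow positions
move Lipschitz in `(a, h)` on bounded windows (`norm_barlowPos_sub_barlowPos_le`), so every
`(R, ε)`-window of `P` is matched by the `k`-th window for all large `k` of the subsequence.
-/

noncomputable section

namespace Summit.AtomisticToContinuum.Crystallization.Theorems

open Literature.MathematicalPhysics.StatisticalMechanics Filter Topology Metric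

/-- Barlow positions are linear in the two spacings: `barlowPos a h = a • barlowPos 1 0 + h • barlowPos 0 1`
(horizontal part scaled by `a`, vertical part by `h`). [folklore] -/
theorem barlowPos_eq_smul_add_smul (a h : ℝ) (s : ℤ → ℤ) (k i j : ℤ) :
    barlowPos a h s k i j = a • barlowPos 1 0 s k i j + h • barlowPos 0 1 s k i j := by
  ext l
  fin_cases l <;> simp <;> ring

/-- Pythagoras for the horizontal/vertical decomposition of a Barlow position:
`‖barlowPos a h‖² = a² ‖barlowPos 1 0‖² + h² ‖barlowPos 0 1‖²`. [folklore] -/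
theorem norm_barlowPos_sq (a h : ℝ) (s : ℤ → ℤ) (k i j : ℤ) :
    ‖barlowPos a h s k i j‖ ^ 2 =
      a ^ 2 * ‖barlowPos 1 0 s k i j‖ ^ 2 + h ^ 2 * ‖barlowPos 0 1 s k i j‖ ^ 2 := by
  simp only [EuclideanSpace.norm_sq_eq, Fin.sum_univ_three, Real.norm_eq_abs, sq_abs,
    barlowPos_apply_zero, barlowPos_apply_one, barlowPos_apply_two]
  ring

/-- **Barlow positions move Lipschitz in the spacings on bounded windows**: for `a, h ≥ 1/2`,
`‖barlowPos a' h' k i j - barlowPos a h k i j‖ ≤ 2 (|a' - a| + |h' - h|) ‖barlowPos a h k i j‖`.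
[folklore] -/
theorem norm_barlowPos_sub_barlowPos_le {a h : ℝ} (ha : 1 / 2 ≤ a) (hh : 1 / 2 ≤ h) (a' h' : ℝ)
    (s : ℤ → ℤ) (k i j : ℤ) :
    ‖barlowPos a' h' s k i j - barlowPos a h s k i j‖ ≤
      2 * (|a' - a| + |h' - h|) * ‖barlowPos a h s k i j‖ := by
  set P₁ := barlowPos 1 0 s k i j with hP₁
  set P₂ := barlowPos 0 1 s k i j with hP₂
  set P := barlowPos a h s k i j with hP
  have hdec : barlowPos a' h' s k i j - P = (a' - a) • P₁ + (h' - h) • P₂ := by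
    rw [hP, barlowPos_eq_smul_add_smul a' h', barlowPos_eq_smul_add_smul a h]
    module
  have hsq : ‖P‖ ^ 2 = a ^ 2 * ‖P₁‖ ^ 2 + h ^ 2 * ‖P₂‖ ^ 2 := norm_barlowPos_sq a h s k i j
  have ha2 : 1 / 4 ≤ a ^ 2 := by nlinarith
  have hh2 : 1 / 4 ≤ h ^ 2 := by nlinarith
  have h1 : ‖P₁‖ ≤ 2 * ‖P‖ := by
    have h1' : ‖P₁‖ ^ 2 ≤ (2 * ‖P‖) ^ 2 := by
      nlinarith [mul_nonneg (sq_nonneg h) (sq_nonneg ‖P₂‖),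
        mul_le_mul_of_nonneg_right ha2 (sq_nonneg ‖P₁‖)]
    exact (pow_le_pow_iff_left₀ (norm_nonneg _) (by positivity) two_ne_zero).1 h1'
  have h2 : ‖P₂‖ ≤ 2 * ‖P‖ := by
    have h2' : ‖P₂‖ ^ 2 ≤ (2 * ‖P‖) ^ 2 := by
      nlinarith [mul_nonneg (sq_nonneg a) (sq_nonneg ‖P₁‖),
        mul_le_mul_of_nonneg_right hh2 (sq_nonneg ‖P₂‖)]
    exact (pow_le_pow_iff_left₀ (norm_nonneg _) (by positivity) two_ne_zero).1 h2'
  calc ‖barlowPos a' h' s k i j - P‖ = ‖(a' - a) • P₁ + (h' - h) • P₂‖ := by rw [hdec]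
    _ ≤ ‖(a' - a) • P₁‖ + ‖(h' - h) • P₂‖ := norm_add_le _ _
    _ = |a' - a| * ‖P₁‖ + |h' - h| * ‖P₂‖ := by
        rw [norm_smul, norm_smul, Real.norm_eq_abs, Real.norm_eq_abs]
    _ ≤ |a' - a| * (2 * ‖P‖) + |h' - h| * (2 * ‖P‖) := by gcongr
    _ = 2 * (|a' - a| + |h' - h|) * ‖P‖ := by ring

/-- **Transport of HCP sites between spacings**: for `a, h ≥ 1/2` every site `q` of
`hcpStacking a h` has a partner `q'` in `hcpStacking a' h'` (same indices) with
`‖q' - q‖ ≤ 2 (|a' - a| + |h' - h|) ‖q‖`. [folklore] -/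
theorem exists_mem_hcpStacking_norm_sub_le {a h : ℝ} (ha : 1 / 2 ≤ a) (hh : 1 / 2 ≤ h)
    (a' h' : ℝ) {q : EuclideanSpace ℝ (Fin 3)} (hq : q ∈ hcpStacking a h) :
    ∃ q' ∈ hcpStacking a' h', ‖q' - q‖ ≤ 2 * (|a' - a| + |h' - h|) * ‖q‖ := by
  obtain ⟨k, i, j, rfl⟩ := hq
  exact ⟨_, barlowPos_mem k i j, norm_barlowPos_sub_barlowPos_le ha hh a' h' _ k i j⟩

/-- The linear isometries of `ℝ³`, as a subset of the continuous linear endomorphisms, form a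
compact set (closed and of operator norm `≤ 1` in a finite-dimensional space). [folklore] -/
theorem isCompact_setOf_norm_map_eq :
    IsCompact {T : EuclideanSpace ℝ (Fin 3) →L[ℝ] EuclideanSpace ℝ (Fin 3) | ∀ v, ‖T v‖ = ‖v‖} := by
  refine (isCompact_closedBall (0 : EuclideanSpace ℝ (Fin 3) →L[ℝ] EuclideanSpace ℝ (Fin 3))
    1).of_isClosed_subset ?_ ?_
  · rw [Set.setOf_forall]
    exact isClosed_iInter fun v =>
      isClosed_eq (ContinuousLinearMap.apply ℝ (EuclideanSpace ℝ (Fin 3)) v).continuous.norm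
        continuous_const
  · intro T hT
    simp only [Set.mem_setOf_eq] at hT
    rw [Metric.mem_closedBall, dist_zero_right]
    exact T.opNorm_le_bound zero_le_one fun v => by rw [hT v, one_mul]

/-- **`HcpWindowsToPeriodicWindows`** (item `stmt-AtomisticToContinuum-14300`, route
`LaminarSixThreeThree`): eventual `(R, ε)`-hcp windows for all `R, ε` give one periodic
configuration whose windows are matched, frequently in `N`, by translates of the ground states.
Compactness glue; see the module docstring for the proof. [folklore] -/
theorem hcpWindowsToPeriodicWindows_proof :
    Summit.AtomisticToContinuum.Crystallization.Theses.LaminarSixThreeThree.HcpWindowsToPeriodicWindows := by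
  unfold Summit.AtomisticToContinuum.Crystallization.Theses.LaminarSixThreeThree.HcpWindowsToPeriodicWindows
  intro hyp x hx
  -- Step 1: along `(R_k, ε_k) = (k + 1, 1/(k + 5))`, an hcp window at some `N ≥ k`, recentred at
  -- the origin of the stacking through HCP homogeneity (`T = A ∘ B`).
  have step : ∀ k : ℕ, ∃ N : ℕ, k ≤ N ∧ ∃ i : Fin N, ∃ a h : ℝ, 1 / 2 < a ∧ a < 2 ∧ 1 / 2 < h ∧
      h < 2 ∧ ∃ T : EuclideanSpace ℝ (Fin 3) →L[ℝ] EuclideanSpace ℝ (Fin 3),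
        (∀ v, ‖T v‖ = ‖v‖) ∧
        (∀ q ∈ hcpStacking a h, ‖q‖ ≤ (k : ℝ) + 1 →
          ∃ j : Fin N, dist (x N j) (x N i + T q) ≤ 1 / ((k : ℝ) + 5)) ∧
        (∀ j : Fin N, dist (x N j) (x N i) ≤ (k : ℝ) + 1 →
          ∃ q ∈ hcpStacking a h, dist (x N j) (x N i + T q) ≤ 1 / ((k : ℝ) + 5)) := by
    intro k
    have hR : (0 : ℝ) < k + 1 := by positivity
    have hε : (0 : ℝ) < 1 / ((k : ℝ) + 5) := by positivity
    have hε' : 1 / ((k : ℝ) + 5) < 1 / 4 := by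
      rw [one_div_lt_one_div (by positivity) (by norm_num)]
      have : (0 : ℝ) ≤ k := k.cast_nonneg
      linarith
    have hev := hyp ((k : ℝ) + 1) (1 / ((k : ℝ) + 5)) hR hε hε' x hx
    obtain ⟨N, hkN, i, a, h, ha1, ha2, hh1, hh2, z, hz, A, hW1, hW2⟩ :=
      ((eventually_ge_atTop k).and hev).exists
    obtain ⟨B, hB⟩ := hcpStacking_homogeneous a h hz
    refine ⟨N, hkN, i, a, h, ha1, ha2, hh1, hh2, (A.comp B.toLinearIsometry).toContinuousLinearMap,
      fun v => (A.comp B.toLinearIsometry).norm_map v, ?_, ?_⟩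
    · intro q hq hqR
      have hp : z + B q ∈ hcpStacking a h := (hB q).1 hq
      have hd : dist (z + B q) z ≤ (k : ℝ) + 1 := by
        rw [dist_eq_norm, add_sub_cancel_left, B.norm_map]
        exact hqR
      obtain ⟨j, hj⟩ := hW1 _ hp hd
      refine ⟨j, ?_⟩
      simpa [add_sub_cancel_left] using hj
    · intro j hj
      obtain ⟨p, hp, hjp⟩ := hW2 j hj
      refine ⟨B.symm (p - z), (hB _).2 (by simpa using hp), ?_⟩
      simpa using hjp
  -- Step 2: choose the data along `k`.
  choose N hN i a h ha1 ha2 hh1 hh2 T hT hW1 hW2 using step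
  -- Step 3: compactness of `[1/2, 2]² × {isometries}` and a convergent subsequence.
  have hK : IsCompact (Set.Icc (1 / 2 : ℝ) 2 ×ˢ (Set.Icc (1 / 2 : ℝ) 2 ×ˢ
      {T : EuclideanSpace ℝ (Fin 3) →L[ℝ] EuclideanSpace ℝ (Fin 3) | ∀ v, ‖T v‖ = ‖v‖})) :=
    isCompact_Icc.prod (isCompact_Icc.prod isCompact_setOf_norm_map_eq)
  have hu : ∀ k, (fun k => (a k, h k, T k)) k ∈ Set.Icc (1 / 2 : ℝ) 2 ×ˢ (Set.Icc (1 / 2 : ℝ) 2 ×ˢ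
      {T : EuclideanSpace ℝ (Fin 3) →L[ℝ] EuclideanSpace ℝ (Fin 3) | ∀ v, ‖T v‖ = ‖v‖}) :=
    fun k => ⟨⟨(ha1 k).le, (ha2 k).le⟩, ⟨(hh1 k).le, (hh2 k).le⟩, hT k⟩
  obtain ⟨⟨a₀, h₀, T₀⟩, ⟨⟨ha₀, -⟩, ⟨hh₀, -⟩, hT₀⟩, φ, hφ, hlim⟩ := hK.tendsto_subseq hu
  simp only [Set.mem_setOf_eq] at hT₀
  have hlim_a : Tendsto (fun k => a (φ k)) atTop (𝓝 a₀) := hlim.fst_nhds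
  have hlim_h : Tendsto (fun k => h (φ k)) atTop (𝓝 h₀) := hlim.snd_nhds.fst_nhds
  have hlim_T : Tendsto (fun k => T (φ k)) atTop (𝓝 T₀) := hlim.snd_nhds.snd_nhds
  -- Step 4: the periodic configuration `P = T₀ (HCP(a₀, h₀))`.
  have ha0 : a₀ ≠ 0 := (by linarith : (0 : ℝ) < a₀).ne'
  have hh0 : h₀ ≠ 0 := (by linarith : (0 : ℝ) < h₀).ne'
  set T₀li : EuclideanSpace ℝ (Fin 3) →ₗᵢ[ℝ] EuclideanSpace ℝ (Fin 3) := ⟨T₀.toLinearMap, hT₀⟩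
    with hT₀li
  set Te : EuclideanSpace ℝ (Fin 3) ≃ₗᵢ[ℝ] EuclideanSpace ℝ (Fin 3) := T₀li.toLinearIsometryEquiv rfl
    with hTe_def
  have hTe : ∀ v, Te v = T₀ v := fun v => rfl
  refine ⟨(hcpPeriodicConfiguration ha0 hh0).isometryImage Te, ?_⟩
  have hpts : ∀ s, s ∈ ((hcpPeriodicConfiguration ha0 hh0).isometryImage Te).points ↔
      ∃ q ∈ hcpStacking a₀ h₀, s = T₀ q := by
    intro s
    rw [PeriodicConfiguration.mem_points_isometryImage, hcpPeriodicConfiguration_points]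
    constructor
    · intro hs
      exact ⟨Te.symm s, hs, by rw [← hTe, Te.apply_symm_apply]⟩
    · rintro ⟨q, hq, rfl⟩
      rw [← hTe, Te.symm_apply_apply]
      exact hq
  -- Step 5: matching of every `(R, ε)`-window, frequently in `N`.
  intro R ε hε
  rw [Filter.frequently_atTop]
  intro M
  set R' : ℝ := max R 0 + 1 with hR'
  have hR0 : 0 ≤ max R 0 := le_max_right _ _
  have hRR : R ≤ max R 0 := le_max_left _ _
  have hR'pos : 0 < R' := by positivity
  set ε₁ : ℝ := min ε 1 with hε₁
  have hε₁pos : 0 < ε₁ := lt_min hε one_pos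
  have hε₁ε : ε₁ ≤ ε := min_le_left _ _
  have hε₁1 : ε₁ ≤ 1 := min_le_right _ _
  set η : ℝ := ε₁ / (10 * R') with hη
  have hηpos : 0 < η := by positivity
  have hηR' : η * R' = ε₁ / 10 := by
    rw [hη]
    field_simp
  have hevk : ∀ᶠ k : ℕ in atTop, (M ≤ k ∧ max R 0 ≤ (k : ℝ) ∧ 2 / ε ≤ (k : ℝ)) ∧
      (dist (a (φ k)) a₀ < η ∧ dist (h (φ k)) h₀ < η ∧ dist (T (φ k)) T₀ < η) := by
    refine ((eventually_ge_atTop M).and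
      ((tendsto_natCast_atTop_atTop.eventually_ge_atTop (max R 0)).and
        (tendsto_natCast_atTop_atTop.eventually_ge_atTop (2 / ε)))).and ?_
    exact (Metric.tendsto_nhds.1 hlim_a η hηpos).and
      ((Metric.tendsto_nhds.1 hlim_h η hηpos).and (Metric.tendsto_nhds.1 hlim_T η hηpos))
  obtain ⟨k, ⟨hkM, hkR, hkε⟩, hka, hkh, hkT⟩ := hevk.exists
  rw [Real.dist_eq] at hka hkh
  rw [dist_eq_norm] at hkT
  set n := φ k with hn
  have hkn : k ≤ n := hφ.id_le k
  have hkn' : (k : ℝ) ≤ n := by exact_mod_cast hkn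
  have h2 : 2 ≤ ε * k := (div_le_iff₀' hε).1 hkε
  have hεn : 1 / ((n : ℝ) + 5) ≤ ε / 2 := by
    rw [div_le_iff₀ (by positivity)]
    have : ε * k ≤ ε * n := mul_le_mul_of_nonneg_left hkn' hε.le
    nlinarith
  have hεn5 : 1 / ((n : ℝ) + 5) ≤ 1 / 5 :=
    one_div_le_one_div_of_le (by norm_num) (by linarith [(n.cast_nonneg : (0 : ℝ) ≤ n)])
  -- operator-norm control of `T n - T₀` on vectors
  have hTv : ∀ v : EuclideanSpace ℝ (Fin 3), ‖T n v - T₀ v‖ ≤ η * ‖v‖ := fun v => by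
    rw [← sub_apply]
    exact ((T n - T₀).le_opNorm v).trans (mul_le_mul_of_nonneg_right hkT.le (norm_nonneg v))
  refine ⟨N n, hkM.trans (hkn.trans (hN n)), -x (N n) (i n), ?_, ?_⟩
  · -- every site of `P` in the ball is near a particle
    intro s hs hsR
    obtain ⟨q, hq, rfl⟩ := (hpts s).1 hs
    have hqR : ‖q‖ ≤ R := by rwa [hT₀ q] at hsR
    have hqR' : ‖q‖ ≤ R' := by linarith
    obtain ⟨q', hq', hqq'⟩ := exists_mem_hcpStacking_norm_sub_le ha₀ hh₀ (a n) (h n) hq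
    have hdq : ‖q' - q‖ ≤ 4 * η * R' :=
      calc ‖q' - q‖ ≤ 2 * (|a n - a₀| + |h n - h₀|) * ‖q‖ := hqq'
        _ ≤ 2 * (η + η) * R' := by gcongr
        _ = 4 * η * R' := by ring
    have hq'norm : ‖q'‖ ≤ (n : ℝ) + 1 := by
      have := norm_le_insert' q' q
      nlinarith
    obtain ⟨j, hj⟩ := hW1 n q' hq' hq'norm
    refine ⟨j, ?_⟩
    have hTT : ‖T n q' - T₀ q‖ ≤ 5 * η * R' :=
      calc ‖T n q' - T₀ q‖ = ‖T n (q' - q) + (T n q - T₀ q)‖ := by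
            congr 1; rw [map_sub]; abel
        _ ≤ ‖T n (q' - q)‖ + ‖T n q - T₀ q‖ := norm_add_le _ _
        _ ≤ ‖q' - q‖ + η * ‖q‖ := by rw [hT n]; exact add_le_add le_rfl (hTv q)
        _ ≤ 4 * η * R' + η * R' := by gcongr
        _ = 5 * η * R' := by ring
    calc dist (x (N n) j + -x (N n) (i n)) (T₀ q)
        = dist (x (N n) j) (x (N n) (i n) + T₀ q) := by
          rw [dist_eq_norm, dist_eq_norm]; congr 1; abel
      _ ≤ dist (x (N n) j) (x (N n) (i n) + T n q') +
            dist (x (N n) (i n) + T n q') (x (N n) (i n) + T₀ q) := dist_triangle _ _ _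
      _ = dist (x (N n) j) (x (N n) (i n) + T n q') + ‖T n q' - T₀ q‖ := by
          rw [dist_add_left, dist_eq_norm ((T n) q') (T₀ q)]
      _ ≤ 1 / ((n : ℝ) + 5) + 5 * η * R' := add_le_add hj hTT
      _ ≤ ε := by nlinarith
  · -- every particle in the ball is near a site of `P`
    intro j hj
    have hjR : dist (x (N n) j) (x (N n) (i n)) ≤ R := by
      rwa [dist_eq_norm, sub_eq_add_neg]
    have hjn : dist (x (N n) j) (x (N n) (i n)) ≤ (n : ℝ) + 1 := by linarith
    obtain ⟨q', hq', hjq'⟩ := hW2 n j hjn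
    have hq'norm : ‖q'‖ ≤ R' := by
      have h1 : ‖q'‖ = dist (x (N n) (i n) + T n q') (x (N n) (i n)) := by
        rw [dist_eq_norm, add_sub_cancel_left, hT n]
      have h2 := dist_triangle_left (x (N n) (i n) + T n q') (x (N n) (i n)) (x (N n) j)
      linarith
    obtain ⟨q, hq, hqq'⟩ := exists_mem_hcpStacking_norm_sub_le (ha1 n).le (hh1 n).le a₀ h₀ hq'
    have hdq : ‖q - q'‖ ≤ 4 * η * R' :=
      calc ‖q - q'‖ ≤ 2 * (|a₀ - a n| + |h₀ - h n|) * ‖q'‖ := hqq'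
        _ ≤ 2 * (η + η) * R' := by
            rw [abs_sub_comm a₀, abs_sub_comm h₀]
            gcongr
        _ = 4 * η * R' := by ring
    refine ⟨T₀ q, (hpts _).2 ⟨q, hq, rfl⟩, ?_⟩
    have hTT : ‖T n q' - T₀ q‖ ≤ 5 * η * R' :=
      calc ‖T n q' - T₀ q‖ = ‖(T n q' - T₀ q') + T₀ (q' - q)‖ := by
            congr 1; rw [map_sub]; abel
        _ ≤ ‖T n q' - T₀ q'‖ + ‖T₀ (q' - q)‖ := norm_add_le _ _
        _ ≤ η * ‖q'‖ + ‖q' - q‖ := by rw [hT₀]; exact add_le_add (hTv q') le_rfl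
        _ ≤ η * R' + 4 * η * R' := by rw [norm_sub_rev]; gcongr
        _ = 5 * η * R' := by ring
    calc dist (x (N n) j + -x (N n) (i n)) (T₀ q)
        = dist (x (N n) j) (x (N n) (i n) + T₀ q) := by
          rw [dist_eq_norm, dist_eq_norm]; congr 1; abel
      _ ≤ dist (x (N n) j) (x (N n) (i n) + T n q') +
            dist (x (N n) (i n) + T n q') (x (N n) (i n) + T₀ q) := dist_triangle _ _ _
      _ = dist (x (N n) j) (x (N n) (i n) + T n q') + ‖T n q' - T₀ q‖ := by
          rw [dist_add_left, dist_eq_norm ((T n) q') (T₀ q)]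
      _ ≤ 1 / ((n : ℝ) + 5) + 5 * η * R' := add_le_add hjq' hTT
      _ ≤ ε := by nlinarith

end Summit.AtomisticToContinuum.Crystallization.Theorems

end
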